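/-
Copyright (c) 2026 the pub-hodgecm-mathlib formalisation cell (harness21).  R90-TF SLAB, section S10 (Rogawski 1990, §13.6–13.8 read at `v`),
prover R90-C138-p02 (g2) — DEAL #77 FILE 2 «the `t₀` ∕ `hex` of record» (dealer R90-C138-plan (g4) 2026-09-05T03:33:34Z; junction J-t₀-mem posted 03:36Z);
h413 = `stmt-HodgeConjecture-24833`, route `HCCMUnconditional`.
-/
import Summits.HodgeConjecture.HodgeConjecture.Theorems.R90S10HexOfRecord          -- ★ #88 (p01 (g0)): `exists_recordGerm_hexFamily_of_levelTraces` (the (H2♭) package IN the germ subtype, modulo `hUnit` = (U-BC)); brings ★ p865075 (H2♭), ★ C2, ★ `LiesOver`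
import Summits.HodgeConjecture.HodgeConjecture.Theorems.R90S10GermOfRecordMem      -- ★ p07 W1-H4′: `norm_classSphericalFunctional_le_heckeBoundOfRecord`, `classSphericalFunctional_heckeStarOfRecord`, pins ★ `bdRec`, `σRec` (+ `_apply`)
import Summits.HodgeConjecture.HodgeConjecture.Theorems.R90S10FrozenFamilyMaps      -- ★ W1-H3: `HeckeQs` (the keystone's token for the Hecke algebras)
import Summits.HodgeConjecture.HodgeConjecture.Theorems.R90S10LiesOverOfContributing -- ★ p864561 (p07): (J1) `isAdmissible_of_isLinked`, (J2) `unopClassSphericalCharacter_eq_of_germOfDiscreteClass_eq`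
import Summits.HodgeConjecture.HodgeConjecture.Theorems.R90S10FrozenDatumPinned      -- ★ C2 read-offs: `S10GCutCore.cl`, `.loc`, `.memG`
import HarnessLib

/-!
# R90-TF ∕ S10 — THE KEYSTONE'S `t₀` OF RECORD IN FILE D's GERM SPACE, AND ITS `hex` FAMILY: the (H2♭) package lifted into `EvpGerm {v} (HeckeQs L) bdRec σRec`
# (`Theorems/R90S10KeystoneT0OfRecord.lean`; ns `Summit.HodgeConjecture.HodgeConjecture.R90.S10`; ONE `def` (the data `t₀OfRecord`, by choice) + theorems; no instance, no notation,
# no named fact, no `sorry`; LAW L9: ★ `Theorems` imports only — definition lane)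

Print: [Rogawski1990] §13.6 p. 209 («e.v.p.» `t(π) = {t_{π_v}}`; «the `t_v` of a unitary `π_v` are bounded»), §13.7 p. 213 (separating by Hecke eigenvalues needs bounded,
star-closed families), §13.8 display (13.8.3) p. 218 L5–7, p. 219 L2–L3 («`π_v = ξ_H(ρ_v)` for all `v ≠ w`»); §10.3 p. 159.  [DeitmarEchterhoff2014] Prop. 6.2.1.
[CartierCorvallis1979] §IV.1 Cor. 4.1–4.2.

## WHY (DEAL #77 FILE 2; RULING #69 «`t₀` order of record = (H2♭) first»; junction J-t₀-mem, this seat 03:36Z)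
The keystone `sock₂Sig_of_inputs … (t₀ : EvpGerm S (HeckeQs L) bd σ) … (hbc) (hex)` (p07 (g2), `R90S10StabilisedAtEvp2OfInputs.lean` :225–:262) reads its germ `t₀` in FILE D's germ
SUBTYPE `{t // (∀ i x, ‖t i x‖ ≤ bd i x) ∧ ∀ i x, t i (σ i x) = conj (t i x)}` at the pins of record `bd := bdRec`, `σ := σRec` (★ `R90S10GermPinsOfRecordDefs`: operator
bounds ∕ adjoints of the Hecke elements on the fixed vectors of representations WITH AN INVARIANT POSITIVE-DEFINITE FORM), whereas (H2♭) ★ `exists_eigenvaluePackage_hexFamily_of_levelTraces`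
delivers a BARE package `t₀ : Ch13Sec6.EigenvaluePackage {v} (…)` whose component at `w` is the eigencharacter of an ADMISSIBLE spherical class `π₀` lying over `ρ_w`.  The
membership `t₀ ∈ GermSub` therefore needs `π₀` UNITARIZABLE (★ W1-H4′ `norm_classSphericalFunctional_le_heckeBoundOfRecord` ∕ `classSphericalFunctional_heckeStarOfRecord` carry
`(hU : c.IsUnitarizable)`); print: `π₀ = ξ_H(ρ_w)` is the spherical constituent of the UNITARILY induced `i_G(χ̃ μ̃)`, hence unitarizable — in the tree this is NOT ★, so it enters
as ONE named local input BY VALUE: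
  **(U-BC) `hUBC : ∀ (w : {w // w ≠ v}) (π : IrrClass (Gqs L w.1)), π.IsAdmissible → π.IsSpherical (U(Φ₃)(𝒪_w)) → LiesOver … π (𝔥.ρ w.1) → π.IsUnitarizable`**
(«every admissible spherical class lying over `ρ_w` is unitarizable»; class (E1-c)-local ∕ unitary unramified base change).
* §1 (generic, any `H`, any `S`): `evp_mem_germSub_of_isUnitarizable` — a package whose components are eigencharacters of UNITARIZABLE spherical classes lies in `GermSub S bdRec σRec`
  (kept for the #94 road (i) re-key: when the (H2♭) family itself carries `π₀.IsUnitarizable`, this lemma puts its package in the germ space with NO letter).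
* §3 (road (M), ZERO letters): `t₀OfRecordOfMember (𝔣) (i₀)` (a member's germ, in the germ space by ★ `germOfDiscreteClass_mem_germSub`) and `hex_ofRecord_of_member` (the member's own
  local classes as witnesses: ★ J1, ★ J2, ★ C2 `memG`).
* §2 **`t₀OfRecord (hunr) (hμω) (𝔣) (hPS) (hUBC) : {t : Ch13Sec6.EigenvaluePackage {v} (HeckeQs L) // ‹pins of record›}`** := `Classical.choose` of ★ #88
  `exists_recordGerm_hexFamily_of_levelTraces hunr hμω 𝔣 {v} (Set.mem_singleton v) hPS hUBC` (dealer (R35′): ONE germ-membership proof in the tree, p01's); `t₀OfRecord_val` (`rfl`); **`hex_ofRecord … : ∀ (w : {w // w ≠ v}) (hwS : w.1 ∉ {v}), ∃ π₀, π₀.IsAdmissible ∧ ∃ h₀,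
  unopClassSphericalCharacter _ π₀ h₀ = (t₀OfRecord …).1 ⟨w.1, hwS⟩ ∧ LiesOver … π₀ (𝔥.ρ w.1)`** — the keystone's `hex` binder (:259–:262) VERBATIM at `S := {v}`, `t₀ := t₀OfRecord …`
  (`Classical.choose_spec`); `hLO_ofRecord` — the `t₀`-free `hLO` binder of `sock₂Sig_of_inputs_of_liesOver` (keystone §3), from (H2♭) with the package forgotten (no (U-BC) needed).
The binders `hPS` (= the shrunk `hPS♭`, audit F-hex-1) and `hUBC` stay BY VALUE — sockets of A's next edition, never discharged here.
HONEST LABEL: a choice-function constant and its spec; pays nothing until ED. 11 cites them; `t₀OfRecord` is conditional on ⟪U⟫, ⟪P⟫'s `hμω`, `hPS♭` ((E1-c)⁺-local) and the NEW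
named residual (U-BC); HC_CM is proved only modulo the 7 printed citations (2 remaining named inputs: hLiu418 = `stmt-HodgeConjecture-24832`, h413 = `stmt-HodgeConjecture-24833`) until
rung 0 closes; REL ≠ ★ ≠ BUILT.
-/

set_option autoImplicit false
set_option linter.dupNamespace false

noncomputable section

open scoped RestrictedProduct Matrix MatrixGroups
open Filter MeasureTheory NumberField IsDedekindDomain CompactlySupported
open Literature.NumberTheory.Rogawski1990 Literature.NumberTheory.Automorphic Literature.NumberTheory.Automorphic.UnitaryGroup
open Literature.NumberTheory.Automorphic.UnitaryGroup.CotangentForms Literature.NumberTheory.GaloisRepresentations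
open Literature.NumberTheory.Automorphic.Arthur2013.Leaves.TECR
open Summit.HodgeConjecture.HodgeConjecture.Cruxes.H413
open Summit.HodgeConjecture.HodgeConjecture.Cruxes.H413.K2E1TraceFormulaBeta
open Summit.HodgeConjecture.HodgeConjecture.Cruxes.H413.K2E1SpectralTermsDiscreteHalf
open Summit.HodgeConjecture.HodgeConjecture.Cruxes.H413.K2E1EigenvaluePackageOfSpherical
open Summit.HodgeConjecture.HodgeConjecture.Cruxes.H413.K2E1EvpOfAutomorphicClass

namespace Summit.HodgeConjecture.HodgeConjecture.R90.S10

/-! ## §1 A package of eigencharacters of UNITARIZABLE spherical classes lies in `GermSub S bdRec σRec` -/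

section Generic

variable {L : Type} [Field L] [NumberField L] [IsCMField L] (H : Matrix (Fin 3) (Fin 3) L)

/-- **Eigencharacters of UNITARIZABLE spherical classes satisfy the pins of record**: if every component `t i` (`i ∉ S`) of a package `t` is the spherical character
`unopClassSphericalCharacter (U(H)(𝒪_i)) (π i) _` of a UNITARIZABLE `U(H)(𝒪_i)`-spherical class `π i`, then `‖t i x‖ ≤ bdRec i x` and
`t i (σRec i x) = conj (t i x)` for all `x ∈ 𝓗_i` (★ W1-H4′ class bounds at the Hecke pair `(U(H)(L⁺_i), U(H)(𝒪_i))`, ★ `isHeckeTriple_cmLocalIntegralLevel`).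
[cite: Rogawski1990, §13.6 p. 209; §13.7 p. 213; §10.3 p. 159] [cite: DeitmarEchterhoff2014, Prop. 6.2.1] -/
theorem evp_mem_germSub_of_isUnitarizable (S : Set (Pl L))
    (t : Ch13Sec6.EigenvaluePackage S fun w => heckeAlgebra ℂ ((cmDatum L 3 H).Local w) (cmLocalIntegralLevel L 3 H w))
    (π : ∀ i : {i : Pl L // i ∉ S}, IrrClass ((cmDatum L 3 H).Local i.1))
    (hsph : ∀ i : {i : Pl L // i ∉ S}, (π i).IsSpherical (cmLocalIntegralLevel L 3 H i.1))
    (hU : ∀ i : {i : Pl L // i ∉ S}, (π i).IsUnitarizable)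
    (ht : ∀ i : {i : Pl L // i ∉ S}, t i = unopClassSphericalCharacter (cmLocalIntegralLevel L 3 H i.1) (π i) (hsph i)) :
    (∀ (i : {i : Pl L // i ∉ S}) (x : heckeAlgebra ℂ ((cmDatum L 3 H).Local i.1) (cmLocalIntegralLevel L 3 H i.1)), ‖t i x‖ ≤ bdRec L H S i x) ∧
      ∀ (i : {i : Pl L // i ∉ S}) (x : heckeAlgebra ℂ ((cmDatum L 3 H).Local i.1) (cmLocalIntegralLevel L 3 H i.1)),
        t i (σRec L H S i x) = (starRingEnd ℂ) (t i x) := by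
  refine ⟨fun i x => ?_, fun i x => ?_⟩
  · haveI := isHeckeTriple_cmLocalIntegralLevel L H i.1
    rw [ht i, unopClassSphericalCharacter_apply, classSphericalCharacter_apply, bdRec_apply]
    exact norm_classSphericalFunctional_le_heckeBoundOfRecord (cmLocalIntegralLevel L 3 H i.1) (π i) (hsph i) (hU i) x
  · haveI := isHeckeTriple_cmLocalIntegralLevel L H i.1
    rw [ht i, unopClassSphericalCharacter_apply, unopClassSphericalCharacter_apply, classSphericalCharacter_apply, classSphericalCharacter_apply, σRec_apply]
    exact classSphericalFunctional_heckeStarOfRecord (cmLocalIntegralLevel L 3 H i.1) (π i) (hsph i) (hU i) x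

end Generic

/-! ## §2 The `t₀` of record at a frozen datum, its `hex` family, and the `t₀`-free `hLO` family -/

section Frozen

variable {L : Type} [Field L] [NumberField L] [IsCMField L] [DecidableEq (Pl L)] {μ : HeckeCharacter L} {v : Pl L}
  [MeasurableSpace (HLoc L v)] [BorelSpace (HLoc L v)] [MeasurableSpace (Gqs L v)] [BorelSpace (Gqs L v)]
  {νHv : Measure (HLoc L v)} {νQv : Measure (Gqs L v)} [νHv.IsHaarMeasure] [νHv.IsMulRightInvariant] [νQv.IsHaarMeasure] [νQv.IsMulRightInvariant]
  [∀ a : HLoc L v, MeasurableSpace (HLoc L v ⧸ Subgroup.centralizer ({a} : Set (HLoc L v)))]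
  [∀ a : HLoc L v, BorelSpace (HLoc L v ⧸ Subgroup.centralizer ({a} : Set (HLoc L v)))]
  [∀ γ : Gqs L v, MeasurableSpace (Gqs L v ⧸ Subgroup.centralizer ({γ} : Set (Gqs L v)))]
  [∀ γ : Gqs L v, BorelSpace (Gqs L v ⧸ Subgroup.centralizer ({γ} : Set (Gqs L v)))]
  {mHv : OrbitalMeasureFamily (HLoc L v)} {mQv : OrbitalMeasureFamily (Gqs L v)} {πSt : IrrClass (HLoc L v)}
  [MeasurableSpace (G3 L).Adelic] [BorelSpace (G3 L).Adelic] [MeasurableSpace (H2 L).Adelic] [BorelSpace (H2 L).Adelic]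
  [MeasurableSpace (GArch L)] [BorelSpace (GArch L)] [MeasurableSpace (HArch L)] [BorelSpace (HArch L)]
  [MeasurableSpace (H1Loc L v)] [MeasurableSpace (H1Arch L)] [MeasurableSpace (H1 L).Adelic] [BorelSpace (H1 L).Adelic]

/-- **THE `t₀` OF RECORD — the (H2♭) package, lifted into FILE D's germ space `EvpGerm {v} (HeckeQs L) bdRec σRec`** by choice, LAYERED OVER ★ #88
`exists_recordGerm_hexFamily_of_levelTraces` (p01 (g0)) at `S := {v}`, `hv := Set.mem_singleton v` (membership at the CHOSEN witnesses `π₀(w)` — admissible spherical classes lying over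
`ρ_w`, unitarizable by the named input (U-BC) = #88's `hUnit`).  Binders: ⟪U⟫ off `v`,
`μ|_{𝕀_{L⁺}} = ω`, the frozen datum, the shrunk level-trace binder `hPS♭` (audit F-hex-1) and (U-BC) — all BY VALUE. [cite: Rogawski1990, §13.8 p. 219 L2–L3; §13.6 p. 209; §13.7 p. 213]
[cite: CartierCorvallis1979, §IV.1 Cor. 4.1–4.2] -/
def t₀OfRecord
    (hunr : ∀ w : Pl L, w ≠ v → ∀ W : PlacesOver L w, Algebra.IsUnramifiedAt (𝓞 ↥(maximalRealSubfield L)) W.1.asIdeal ∧ μ.IsUnramifiedAt W.1)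
    (hμω : ∀ x : Literature.NumberTheory.GaloisRepresentations.ideleGroup ↥(maximalRealSubfield L),
      μ (AdeleRing.ideleBaseChange (↥(maximalRealSubfield L)) L x) = quadraticHeckeCharCM L x)
    (𝔣 : S10FrozenDatum L μ v νHv νQv mHv mQv πSt)
    (hPS : ∀ w : {w : Pl L // w ≠ v}, ∃ (χ₂ : ↥(torusU (conjLocal L (IsCMField.complexConj L) w.1) (cmLocalForm L 2 w.1)) →* ℂˣ) (χ₁ : H1Loc L w.1 →* ℂˣ),
      IsOpen ((χ₁.ker : Subgroup (H1Loc L w.1)) : Set (H1Loc L w.1)) ∧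
        Module.finrank ℂ ↥((cmPrincipalSeriesH L w.1 χ₂ χ₁).fixedPoints (𝔣.𝔥.KH w.1)) = 1 ∧
          (letI := 𝔣.𝔥.acV w.1
           letI := 𝔣.𝔥.mdV w.1
           letI := 𝔣.𝔳.msH w
           ∀ fH : HLoc L w.1 → ℂ, IsLocSmooth fH → IsLevel (𝔣.𝔥.KH w.1) fH →
             (𝔣.𝔥.ρ w.1).smoothTrace (𝔣.𝔳.νHw w) fH = (cmPrincipalSeriesH L w.1 χ₂ χ₁).smoothTrace (𝔣.𝔳.νHw w) fH))
    (hUBC : ∀ (w : {w : Pl L // w ≠ v}) (π : IrrClass (Gqs L w.1)), π.IsAdmissible → π.IsSpherical (cmLocalIntegralLevel L 3 (qsForm L) w.1) →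
      LiesOver L μ w.1 (𝔣.𝔳.K w.1) (𝔣.𝔥.KH w.1) (𝔣.𝔳.νQ w) (𝔣.𝔳.νHw w) (𝔣.𝔳.mH w) (𝔣.𝔳.mQ w) π (𝔣.𝔥.ρ w.1) → π.IsUnitarizable) :
    {t : Ch13Sec6.EigenvaluePackage ({v} : Set (Pl L)) (HeckeQs L) //
      (∀ (i : {i : Pl L // i ∉ ({v} : Set (Pl L))}) (x : HeckeQs L i.1), ‖t i x‖ ≤ bdRec L (qsForm L) {v} i x) ∧
        ∀ (i : {i : Pl L // i ∉ ({v} : Set (Pl L))}) (x : HeckeQs L i.1), t i (σRec L (qsForm L) {v} i x) = (starRingEnd ℂ) (t i x)} :=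
  Classical.choose (exists_recordGerm_hexFamily_of_levelTraces hunr hμω 𝔣 {v} (Set.mem_singleton v) hPS hUBC)

/-- `t₀OfRecord` is the CHOSEN element of ★ #88 `exists_recordGerm_hexFamily_of_levelTraces` at `S := {v}` (unfolding, `rfl`). [cite: Rogawski1990, §13.6 p. 209] -/
theorem t₀OfRecord_val
    (hunr : ∀ w : Pl L, w ≠ v → ∀ W : PlacesOver L w, Algebra.IsUnramifiedAt (𝓞 ↥(maximalRealSubfield L)) W.1.asIdeal ∧ μ.IsUnramifiedAt W.1)
    (hμω : ∀ x : Literature.NumberTheory.GaloisRepresentations.ideleGroup ↥(maximalRealSubfield L),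
      μ (AdeleRing.ideleBaseChange (↥(maximalRealSubfield L)) L x) = quadraticHeckeCharCM L x)
    (𝔣 : S10FrozenDatum L μ v νHv νQv mHv mQv πSt)
    (hPS : ∀ w : {w : Pl L // w ≠ v}, ∃ (χ₂ : ↥(torusU (conjLocal L (IsCMField.complexConj L) w.1) (cmLocalForm L 2 w.1)) →* ℂˣ) (χ₁ : H1Loc L w.1 →* ℂˣ),
      IsOpen ((χ₁.ker : Subgroup (H1Loc L w.1)) : Set (H1Loc L w.1)) ∧
        Module.finrank ℂ ↥((cmPrincipalSeriesH L w.1 χ₂ χ₁).fixedPoints (𝔣.𝔥.KH w.1)) = 1 ∧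
          (letI := 𝔣.𝔥.acV w.1
           letI := 𝔣.𝔥.mdV w.1
           letI := 𝔣.𝔳.msH w
           ∀ fH : HLoc L w.1 → ℂ, IsLocSmooth fH → IsLevel (𝔣.𝔥.KH w.1) fH →
             (𝔣.𝔥.ρ w.1).smoothTrace (𝔣.𝔳.νHw w) fH = (cmPrincipalSeriesH L w.1 χ₂ χ₁).smoothTrace (𝔣.𝔳.νHw w) fH))
    (hUBC : ∀ (w : {w : Pl L // w ≠ v}) (π : IrrClass (Gqs L w.1)), π.IsAdmissible → π.IsSpherical (cmLocalIntegralLevel L 3 (qsForm L) w.1) →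
      LiesOver L μ w.1 (𝔣.𝔳.K w.1) (𝔣.𝔥.KH w.1) (𝔣.𝔳.νQ w) (𝔣.𝔳.νHw w) (𝔣.𝔳.mH w) (𝔣.𝔳.mQ w) π (𝔣.𝔥.ρ w.1) → π.IsUnitarizable) :
    t₀OfRecord hunr hμω 𝔣 hPS hUBC = Classical.choose (exists_recordGerm_hexFamily_of_levelTraces hunr hμω 𝔣 {v} (Set.mem_singleton v) hPS hUBC) :=
  rfl

/-- **`hex` OF RECORD — the keystone's ROW-6 binder at `t₀ := t₀OfRecord …`, `S := {v}`** (p07 (g2) `sock₂Sig_of_inputs` :259–:262 VERBATIM at the frozen datum `𝔣`): at every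
`w ≠ v` an ADMISSIBLE `U(Φ₃)(𝒪_w)`-spherical class of Hecke character `(t₀OfRecord …).1 ⟨w, _⟩` LIES OVER `ρ_w` — the spec of the choice (★ (H2♭)).
[cite: Rogawski1990, §13.8 p. 219 L2–L3; §13.6 p. 209] [cite: CartierCorvallis1979, §IV.1 Cor. 4.1–4.2] -/
theorem hex_ofRecord
    (hunr : ∀ w : Pl L, w ≠ v → ∀ W : PlacesOver L w, Algebra.IsUnramifiedAt (𝓞 ↥(maximalRealSubfield L)) W.1.asIdeal ∧ μ.IsUnramifiedAt W.1)
    (hμω : ∀ x : Literature.NumberTheory.GaloisRepresentations.ideleGroup ↥(maximalRealSubfield L),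
      μ (AdeleRing.ideleBaseChange (↥(maximalRealSubfield L)) L x) = quadraticHeckeCharCM L x)
    (𝔣 : S10FrozenDatum L μ v νHv νQv mHv mQv πSt)
    (hPS : ∀ w : {w : Pl L // w ≠ v}, ∃ (χ₂ : ↥(torusU (conjLocal L (IsCMField.complexConj L) w.1) (cmLocalForm L 2 w.1)) →* ℂˣ) (χ₁ : H1Loc L w.1 →* ℂˣ),
      IsOpen ((χ₁.ker : Subgroup (H1Loc L w.1)) : Set (H1Loc L w.1)) ∧
        Module.finrank ℂ ↥((cmPrincipalSeriesH L w.1 χ₂ χ₁).fixedPoints (𝔣.𝔥.KH w.1)) = 1 ∧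
          (letI := 𝔣.𝔥.acV w.1
           letI := 𝔣.𝔥.mdV w.1
           letI := 𝔣.𝔳.msH w
           ∀ fH : HLoc L w.1 → ℂ, IsLocSmooth fH → IsLevel (𝔣.𝔥.KH w.1) fH →
             (𝔣.𝔥.ρ w.1).smoothTrace (𝔣.𝔳.νHw w) fH = (cmPrincipalSeriesH L w.1 χ₂ χ₁).smoothTrace (𝔣.𝔳.νHw w) fH))
    (hUBC : ∀ (w : {w : Pl L // w ≠ v}) (π : IrrClass (Gqs L w.1)), π.IsAdmissible → π.IsSpherical (cmLocalIntegralLevel L 3 (qsForm L) w.1) →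
      LiesOver L μ w.1 (𝔣.𝔳.K w.1) (𝔣.𝔥.KH w.1) (𝔣.𝔳.νQ w) (𝔣.𝔳.νHw w) (𝔣.𝔳.mH w) (𝔣.𝔳.mQ w) π (𝔣.𝔥.ρ w.1) → π.IsUnitarizable) :
    ∀ (w : {w : Pl L // w ≠ v}) (hwS : w.1 ∉ ({v} : Set (Pl L))), ∃ π₀ : IrrClass (Gqs L w.1), π₀.IsAdmissible ∧
      ∃ h₀ : π₀.IsSpherical (cmLocalIntegralLevel L 3 (qsForm L) w.1),
        unopClassSphericalCharacter (cmLocalIntegralLevel L 3 (qsForm L) w.1) π₀ h₀ = (t₀OfRecord hunr hμω 𝔣 hPS hUBC).1 ⟨w.1, hwS⟩ ∧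
          LiesOver L μ w.1 (𝔣.𝔳.K w.1) (𝔣.𝔥.KH w.1) (𝔣.𝔳.νQ w) (𝔣.𝔳.νHw w) (𝔣.𝔳.mH w) (𝔣.𝔳.mQ w) π₀ (𝔣.𝔥.ρ w.1) :=
  Classical.choose_spec (exists_recordGerm_hexFamily_of_levelTraces hunr hμω 𝔣 {v} (Set.mem_singleton v) hPS hUBC)

/-- **`hLO` OF RECORD — the `t₀`-FREE row-6 binder of `sock₂Sig_of_inputs_of_liesOver`** (keystone §3: at every `w ≠ v` SOME admissible spherical class lies over `ρ_w`): (H2♭) with the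
package forgotten; needs ⟪U⟫, `hμω`, `hPS♭` only — NO unitarizability. [cite: Rogawski1990, §13.8 p. 219 L2–L3] [cite: CartierCorvallis1979, §IV.1 Cor. 4.1–4.2] -/
theorem hLO_ofRecord
    (hunr : ∀ w : Pl L, w ≠ v → ∀ W : PlacesOver L w, Algebra.IsUnramifiedAt (𝓞 ↥(maximalRealSubfield L)) W.1.asIdeal ∧ μ.IsUnramifiedAt W.1)
    (hμω : ∀ x : Literature.NumberTheory.GaloisRepresentations.ideleGroup ↥(maximalRealSubfield L),
      μ (AdeleRing.ideleBaseChange (↥(maximalRealSubfield L)) L x) = quadraticHeckeCharCM L x)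
    (𝔣 : S10FrozenDatum L μ v νHv νQv mHv mQv πSt)
    (hPS : ∀ w : {w : Pl L // w ≠ v}, ∃ (χ₂ : ↥(torusU (conjLocal L (IsCMField.complexConj L) w.1) (cmLocalForm L 2 w.1)) →* ℂˣ) (χ₁ : H1Loc L w.1 →* ℂˣ),
      IsOpen ((χ₁.ker : Subgroup (H1Loc L w.1)) : Set (H1Loc L w.1)) ∧
        Module.finrank ℂ ↥((cmPrincipalSeriesH L w.1 χ₂ χ₁).fixedPoints (𝔣.𝔥.KH w.1)) = 1 ∧
          (letI := 𝔣.𝔥.acV w.1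
           letI := 𝔣.𝔥.mdV w.1
           letI := 𝔣.𝔳.msH w
           ∀ fH : HLoc L w.1 → ℂ, IsLocSmooth fH → IsLevel (𝔣.𝔥.KH w.1) fH →
             (𝔣.𝔥.ρ w.1).smoothTrace (𝔣.𝔳.νHw w) fH = (cmPrincipalSeriesH L w.1 χ₂ χ₁).smoothTrace (𝔣.𝔳.νHw w) fH)) :
    ∀ w : {w : Pl L // w ≠ v}, ∃ π₀ : IrrClass (Gqs L w.1), π₀.IsAdmissible ∧ π₀.IsSpherical (cmLocalIntegralLevel L 3 (qsForm L) w.1) ∧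
      LiesOver L μ w.1 (𝔣.𝔳.K w.1) (𝔣.𝔥.KH w.1) (𝔣.𝔳.νQ w) (𝔣.𝔳.νHw w) (𝔣.𝔳.mH w) (𝔣.𝔳.mQ w) π₀ (𝔣.𝔥.ρ w.1) := fun w => by
  obtain ⟨_, h⟩ := exists_eigenvaluePackage_hexFamily_of_levelTraces hunr hμω 𝔣 hPS
  obtain ⟨π₀, hadm₀, h₀, -, hLO₀⟩ := h w
  exact ⟨π₀, hadm₀, h₀, hLO₀⟩

/-! ## §3 (M) THE MEMBER ROAD — ZERO letters when the cut of record has a member `i₀` -/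

/-- **THE `t₀` OF RECORD FROM A MEMBER (road (M), ZERO letters)** — if the `G`-side cut has a member `i₀`, its germ `germOfDiscreteClass {v} [P i₀]` lies in FILE D's germ space BY ★
`germOfDiscreteClass_mem_germSub` (members' local classes are UNITARIZABLE, so the pins of record hold unconditionally). [cite: Rogawski1990, §13.6 p. 209; §13.8 p. 218 L5–7; §10.3 p. 159] -/
def t₀OfRecordOfMember (𝔣 : S10FrozenDatum L μ v νHv νQv mHv mQv πSt) (i₀ : 𝔣.𝔤.ι) :
    {t : Ch13Sec6.EigenvaluePackage ({v} : Set (Pl L)) (HeckeQs L) //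
      (∀ (i : {i : Pl L // i ∉ ({v} : Set (Pl L))}) (x : HeckeQs L i.1), ‖t i x‖ ≤ bdRec L (qsForm L) {v} i x) ∧
        ∀ (i : {i : Pl L // i ∉ ({v} : Set (Pl L))}) (x : HeckeQs L i.1), t i (σRec L (qsForm L) {v} i x) = (starRingEnd ℂ) (t i x)} :=
  haveI := 𝔣.𝔤.hμG
  ⟨germOfDiscreteClass {v} (𝔣.𝔤.cl i₀), germOfDiscreteClass_mem_germSub {v} _⟩

/-- **`hex` OF RECORD FROM A MEMBER (road (M), ZERO letters)**: at `t₀ := t₀OfRecordOfMember 𝔣 i₀` the keystone's `hex` binder holds with the member's OWN local classes as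
witnesses — `[ρc i₀ w]` is admissible (★ (J1) `isAdmissible_of_isLinked`, members are `IsLinked` by ★ C2 `S10MemG`), `U(Φ₃)(𝒪_w)`-spherical and LYING OVER `ρ_w` (★ C2 `memG`, ★
`S10Frozen.hKstd`), and its Hecke eigencharacter IS the germ's component (★ (J2) `unopClassSphericalCharacter_eq_of_germOfDiscreteClass_eq`).  No `hPS♭`, no (U-BC), no FL.
[cite: Rogawski1990, §13.8 p. 219 L2–L3; §13.6 p. 209] [cite: FlathCorvallis1979, Thm. 3] [cite: CartierCorvallis1979, §IV.1 Cor. 4.1] -/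
theorem hex_ofRecord_of_member (𝔣 : S10FrozenDatum L μ v νHv νQv mHv mQv πSt) (i₀ : 𝔣.𝔤.ι) :
    ∀ (w : {w : Pl L // w ≠ v}) (hwS : w.1 ∉ ({v} : Set (Pl L))), ∃ π₀ : IrrClass (Gqs L w.1), π₀.IsAdmissible ∧
      ∃ h₀ : π₀.IsSpherical (cmLocalIntegralLevel L 3 (qsForm L) w.1),
        unopClassSphericalCharacter (cmLocalIntegralLevel L 3 (qsForm L) w.1) π₀ h₀ = (t₀OfRecordOfMember 𝔣 i₀).1 ⟨w.1, hwS⟩ ∧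
          LiesOver L μ w.1 (𝔣.𝔳.K w.1) (𝔣.𝔥.KH w.1) (𝔣.𝔳.νQ w) (𝔣.𝔳.νHw w) (𝔣.𝔳.mH w) (𝔣.𝔳.mQ w) π₀ (𝔣.𝔥.ρ w.1) := by
  intro w hwS
  haveI := 𝔣.𝔤.hμG
  have hmem := 𝔣.𝔤.memG i₀
  have hsph : ∀ w', w' ∉ ({v} : Set (Pl L)) → (𝔣.𝔤.loc i₀ w').IsSpherical (cmLocalIntegralLevel L 3 (qsForm L) w') := fun w' hw' => by
    have hne : w' ≠ v := fun h => hw' (Set.mem_singleton_iff.2 h)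
    have h := (hmem.2 ⟨w', hne⟩).1
    rwa [𝔣.𝔳.hKstd w' hne] at h
  exact ⟨𝔣.𝔤.loc i₀ w.1, isAdmissible_of_isLinked L (qsForm L) (𝔣.𝔤.cl i₀) hmem.1 w.1, hsph w.1 hwS,
    unopClassSphericalCharacter_eq_of_germOfDiscreteClass_eq L (qsForm L) {v} (𝔣.𝔤.cl i₀) hmem.1 hsph rfl hwS, hmem.2 w⟩

end Frozen

end Summit.HodgeConjecture.HodgeConjecture.R90.S10

end
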